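import Summits.AtomisticToContinuum.FouriersLaw.Theorems.VanishingNoiseTransferNoiseLocalityReductionAux

/-!
# `NoiseLocality` (stmt-AtomisticToContinuum-11975) REDUCED to the relative flip-energy bound C⁺ and the noisy Fourier law X3 — part 2

Composition of line `relative-flip-energy-transfer` (lead `prover-line-stmt-AtomisticToContinuum-11975-0`); see part 1
(`…ReductionAux`) for the vocabulary conventions, the glue and the derived floor. Main theorem:
`noiseLocality_of_relativeFlipEnergyBound : C⁺ → VanishingNoiseTransfer.NoisyFourier → VanishingNoiseTransfer.NoiseLocality`
(a CONDITIONAL result: C⁺ is the registered open stub `stub_relativeFlipEnergyBound`; nothing here closes the item).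
-/

noncomputable section

open MeasureTheory Filter Topology
open scoped ContDiff BigOperators

namespace Summit.AtomisticToContinuum.FouriersLaw.Theorems.NoiseLocality.Reduction

open Literature.MathematicalPhysics.KineticTheory.HeatConduction

/-! ## The composition -/

/-- **The composition**: C⁺ (hypothesis `hC`) and an `N`-uniform deterministic floor `hF` give the crux `NoiseLocality` with the
explicit modulus `w(ε) = T√(2A⁺ε/d) + 4T²A⁺ε` — at each `N ≥ 2`: response densities from the landed stubs 1a/1b, the master
inequality `|D_ε − D₀|² ≤ T² ε D_ε (N−1)𝓔_f(U₀)` from the landed stubs 2/3 (`master_sq`), then `divisionFree_of_master`; `N ≤ 1`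
is currentless (`D₀ = D_ε`). [folklore] -/
theorem noiseLocality_of_floor (hC : ∀ ω₂ lam β γ : ℝ, 0 < ω₂ → 0 < lam → 0 < β → 0 < γ → ∀ T : ℝ, 0 < T → ∃ A : ℝ, ∀ (N : ℕ)
    (μ0 : ℝ → ℝ → MeasureTheory.Measure (Literature.MathematicalPhysics.KineticTheory.HeatConduction.PhaseSpace N)),
    (∀ T_L T_R : ℝ, 0 < T_L → 0 < T_R →
      (Literature.MathematicalPhysics.KineticTheory.HeatConduction.pinnedChain ω₂ lam β γ).IsSteadyState N T_L T_R
          (μ0 T_L T_R) ∧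
        ∀ ν : MeasureTheory.Measure (Literature.MathematicalPhysics.KineticTheory.HeatConduction.PhaseSpace N),
          (Literature.MathematicalPhysics.KineticTheory.HeatConduction.pinnedChain ω₂ lam β γ).IsSteadyState N T_L T_R ν →
            ν = μ0 T_L T_R) →
    ∀ U0 : Literature.MathematicalPhysics.KineticTheory.HeatConduction.PhaseSpace N → ℝ,
    (MeasureTheory.MemLp U0 2
          ((Literature.MathematicalPhysics.KineticTheory.HeatConduction.pinnedChain ω₂ lam β γ).gibbsMeasure N T) ∧
        (∀ g : Literature.MathematicalPhysics.KineticTheory.HeatConduction.PhaseSpace N → ℝ,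
          ContDiff ℝ ((⊤ : ℕ∞) : WithTop ℕ∞) g → HasCompactSupport g →
            HasDerivAt (fun δ : ℝ => ∫ x, g x ∂(μ0 (T + δ / 2) (T - δ / 2)))
              (∫ x, g x * U0 x
                ∂((Literature.MathematicalPhysics.KineticTheory.HeatConduction.pinnedChain ω₂ lam β γ).gibbsMeasure N T))
              0) ∧
        HasDerivAt (fun δ : ℝ =>
            (Literature.MathematicalPhysics.KineticTheory.HeatConduction.pinnedChain ω₂ lam β γ).totalCurrent
              (μ0 (T + δ / 2) (T - δ / 2)))
          (∑ i : Fin N, ∫ x,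
            (Literature.MathematicalPhysics.KineticTheory.HeatConduction.pinnedChain ω₂ lam β γ).bondCurrent N i x * U0 x
              ∂((Literature.MathematicalPhysics.KineticTheory.HeatConduction.pinnedChain ω₂ lam β γ).gibbsMeasure N T))
          0) →
    ∀ D0 : ℝ,
    Filter.Tendsto (fun δ : ℝ =>
        (Literature.MathematicalPhysics.KineticTheory.HeatConduction.pinnedChain ω₂ lam β γ).totalCurrent
          (μ0 (T + δ / 2) (T - δ / 2)) / δ) (nhdsWithin 0 {(0 : ℝ)}ᶜ) (nhds D0) →
    ((N : ℝ) - 1) *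
        ((1 / 2) * ∑ i : Fin N, ∫ x,
          (U0 x - U0 (Literature.MathematicalPhysics.KineticTheory.HeatConduction.momentumFlip i x)) ^ 2
            ∂((Literature.MathematicalPhysics.KineticTheory.HeatConduction.pinnedChain ω₂ lam β γ).gibbsMeasure N T)) ≤
      A * D0 ^ 2)
    (hF : ∀ ω₂ lam β γ : ℝ, 0 < ω₂ → 0 < lam → 0 < β → 0 < γ → ∀ T : ℝ, 0 < T → ∃ d : ℝ, 0 < d ∧
      ∀ N : ℕ, 2 ≤ N → ∀ μ0 : ℝ → ℝ → Measure (PhaseSpace N),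
        (∀ T_L T_R : ℝ, 0 < T_L → 0 < T_R → (pinnedChain ω₂ lam β γ).IsSteadyState N T_L T_R (μ0 T_L T_R) ∧ ∀ ν : Measure (PhaseSpace N), (pinnedChain ω₂ lam β γ).IsSteadyState N T_L T_R ν → ν = μ0 T_L T_R) →
          ∀ D0 : ℝ, Tendsto (fun δ : ℝ => (pinnedChain ω₂ lam β γ).totalCurrent (μ0 (T + δ / 2) (T - δ / 2)) / δ) (𝓝[≠] 0) (𝓝 D0) → d ≤ D0) :
    Summit.AtomisticToContinuum.FouriersLaw.Theses.VanishingNoiseTransfer.NoiseLocality := by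
  intro ω₂ lam β γ hω hl hβ hγ S hS T hT
  obtain ⟨A, hA⟩ := hC ω₂ lam β γ hω hl hβ hγ T hT
  obtain ⟨d, hd, hfloor⟩ := hF ω₂ lam β γ hω hl hβ hγ T hT
  refine ⟨fun ε => T * Real.sqrt (2 * (max A 0) * ε / d) + 4 * T ^ 2 * (max A 0) * ε,
    tendsto_modulus T (max A 0) d, ?_⟩
  intro N ε hε hε1 μ0 με hμ0 hμε D0 Dε hD0 hDε
  subst hS
  -- the crux hypotheses
  have hμ0' : ∀ T_L T_R : ℝ, 0 < T_L → 0 < T_R →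
      (pinnedChain ω₂ lam β γ).IsSteadyState N T_L T_R (μ0 T_L T_R) ∧
        ∀ ν : Measure (PhaseSpace N), (pinnedChain ω₂ lam β γ).IsSteadyState N T_L T_R ν → ν = μ0 T_L T_R := hμ0
  have hμε' : ∀ T_L T_R : ℝ, 0 < T_L → 0 < T_R →
      (pinnedChain ω₂ lam β γ).IsFlipSteadyState N T_L T_R ε (με T_L T_R) ∧
        ∀ ν : Measure (PhaseSpace N), (pinnedChain ω₂ lam β γ).IsFlipSteadyState N T_L T_R ε ν → ν = με T_L T_R :=
    hμε
  have hD0' : Tendsto (fun δ : ℝ => (pinnedChain ω₂ lam β γ).totalCurrent (μ0 (T + δ / 2) (T - δ / 2)) / δ)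
      (𝓝[≠] 0) (𝓝 D0) := hD0
  have hDε' : Tendsto (fun δ : ℝ => (pinnedChain ω₂ lam β γ).totalCurrent (με (T + δ / 2) (T - δ / 2)) / δ)
      (𝓝[≠] 0) (𝓝 Dε) := hDε
  -- response densities (stub 1) and the three inequalities (stubs 2, 3, 4)
  obtain ⟨U0, hU0⟩ := Summit.AtomisticToContinuum.FouriersLaw.Theorems.NoiseLocality.stub_responseDensityDet ω₂ lam β γ hω hl hβ hγ T hT N μ0 hμ0'
  obtain ⟨Uε, hUε⟩ := Summit.AtomisticToContinuum.FouriersLaw.Theorems.NoiseLocality.stub_responseDensityNoisy ω₂ lam β γ hω hl hβ hγ T hT N ε hε με hμε'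
  have h1 := Summit.AtomisticToContinuum.FouriersLaw.Theorems.NoiseLocality.stub_duhamelFlipBound ω₂ lam β γ hω hl hβ hγ T hT N ε hε μ0 με hμ0' hμε' U0 Uε hU0 hUε D0 Dε hD0' hDε'
  have h2 := Summit.AtomisticToContinuum.FouriersLaw.Theorems.NoiseLocality.stub_flipDissipationBound ω₂ lam β γ hω hl hβ hγ T hT N ε hε με hμε' Uε hUε Dε hDε'
  have h3 := hA N μ0 hμ0' U0 hU0 D0 hD0'
  have hE0 := flipEnergy_nonneg ((pinnedChain ω₂ lam β γ).gibbsMeasure N T) U0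
  have hEε := flipEnergy_nonneg ((pinnedChain ω₂ lam β γ).gibbsMeasure N T) Uε
  show |D0 - Dε| ≤ (T * Real.sqrt (2 * (max A 0) * ε / d) + 4 * T ^ 2 * (max A 0) * ε) * |D0| * |Dε|
  rcases lt_or_ge N 2 with hN | hN
  · -- N ≤ 1: no bond, both coefficients agree (indeed vanish); the bound is 0 ≤ RHS
    have hN1 : (N : ℝ) - 1 ≤ 0 := by
      have : (N : ℝ) ≤ 1 := by exact_mod_cast Nat.lt_succ_iff.mp hN
      linarith
    have hrhs : ε * ((N : ℝ) - 1) * T ^ 2 *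
        Real.sqrt (((1 / 2) * ∑ i : Fin N, ∫ x, (Uε x - Uε (momentumFlip i x)) ^ 2 ∂((pinnedChain ω₂ lam β γ).gibbsMeasure N T))) *
          Real.sqrt (((1 / 2) * ∑ i : Fin N, ∫ x, (U0 x - U0 (momentumFlip i x)) ^ 2 ∂((pinnedChain ω₂ lam β γ).gibbsMeasure N T))) ≤ 0 := by
      have e : ε * ((N : ℝ) - 1) * T ^ 2 *
          Real.sqrt (((1 / 2) * ∑ i : Fin N, ∫ x, (Uε x - Uε (momentumFlip i x)) ^ 2 ∂((pinnedChain ω₂ lam β γ).gibbsMeasure N T))) *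
            Real.sqrt (((1 / 2) * ∑ i : Fin N, ∫ x, (U0 x - U0 (momentumFlip i x)) ^ 2 ∂((pinnedChain ω₂ lam β γ).gibbsMeasure N T))) =
          ((N : ℝ) - 1) * (ε * T ^ 2 * Real.sqrt (((1 / 2) * ∑ i : Fin N, ∫ x, (Uε x - Uε (momentumFlip i x)) ^ 2 ∂((pinnedChain ω₂ lam β γ).gibbsMeasure N T))) *
            Real.sqrt (((1 / 2) * ∑ i : Fin N, ∫ x, (U0 x - U0 (momentumFlip i x)) ^ 2 ∂((pinnedChain ω₂ lam β γ).gibbsMeasure N T)))) := by ring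
      rw [e]
      exact mul_nonpos_iff.mpr (Or.inr ⟨hN1, by positivity⟩)
    have heq : Dε = D0 := by
      have : |Dε - D0| ≤ 0 := h1.trans hrhs
      have := abs_nonpos_iff.mp this
      linarith
    rw [heq, sub_self, abs_zero]
    positivity
  · -- N ≥ 2: master inequality + relative flip-energy bound + floor
    have hn : 0 ≤ (N : ℝ) - 1 := by
      have : (2 : ℝ) ≤ N := by exact_mod_cast hN
      linarith
    have hDεnn : 0 ≤ Dε :=
      le_trans (mul_nonneg (mul_nonneg (mul_nonneg hε.le hn) (sq_nonneg T)) hEε) h2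
    have key := master_sq hε.le hn hEε hE0 h1 h2
    have h3' : ((N : ℝ) - 1) * ((1 / 2) * ∑ i : Fin N, ∫ x, (U0 x - U0 (momentumFlip i x)) ^ 2 ∂((pinnedChain ω₂ lam β γ).gibbsMeasure N T)) ≤ max A 0 * D0 ^ 2 :=
      h3.trans (mul_le_mul_of_nonneg_right (le_max_left A 0) (sq_nonneg D0))
    exact divisionFree_of_master hT hε (le_max_right A 0) hd (hfloor N hN μ0 hμ0' D0 hD0') hDεnn
      key h3'


/-- **`NoiseLocality` from C⁺ and X3** (conditional result of line `relative-flip-energy-transfer`): the relative flip-energy bound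
`RelativeFlipEnergyBoundText` (the line's one open `N`-uniform stub) and the route's sibling crux `NoisyFourier` (stmt-11977, at rate
`1`) imply the crux `VanishingNoiseTransfer.NoiseLocality` — all fixed-`N` inputs being theorems of the tree. [folklore] -/
theorem noiseLocality_of_relativeFlipEnergyBound (hC : ∀ ω₂ lam β γ : ℝ, 0 < ω₂ → 0 < lam → 0 < β → 0 < γ → ∀ T : ℝ, 0 < T → ∃ A : ℝ, ∀ (N : ℕ)
    (μ0 : ℝ → ℝ → MeasureTheory.Measure (Literature.MathematicalPhysics.KineticTheory.HeatConduction.PhaseSpace N)),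
    (∀ T_L T_R : ℝ, 0 < T_L → 0 < T_R →
      (Literature.MathematicalPhysics.KineticTheory.HeatConduction.pinnedChain ω₂ lam β γ).IsSteadyState N T_L T_R
          (μ0 T_L T_R) ∧
        ∀ ν : MeasureTheory.Measure (Literature.MathematicalPhysics.KineticTheory.HeatConduction.PhaseSpace N),
          (Literature.MathematicalPhysics.KineticTheory.HeatConduction.pinnedChain ω₂ lam β γ).IsSteadyState N T_L T_R ν →
            ν = μ0 T_L T_R) →
    ∀ U0 : Literature.MathematicalPhysics.KineticTheory.HeatConduction.PhaseSpace N → ℝ,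
    (MeasureTheory.MemLp U0 2
          ((Literature.MathematicalPhysics.KineticTheory.HeatConduction.pinnedChain ω₂ lam β γ).gibbsMeasure N T) ∧
        (∀ g : Literature.MathematicalPhysics.KineticTheory.HeatConduction.PhaseSpace N → ℝ,
          ContDiff ℝ ((⊤ : ℕ∞) : WithTop ℕ∞) g → HasCompactSupport g →
            HasDerivAt (fun δ : ℝ => ∫ x, g x ∂(μ0 (T + δ / 2) (T - δ / 2)))
              (∫ x, g x * U0 x
                ∂((Literature.MathematicalPhysics.KineticTheory.HeatConduction.pinnedChain ω₂ lam β γ).gibbsMeasure N T))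
              0) ∧
        HasDerivAt (fun δ : ℝ =>
            (Literature.MathematicalPhysics.KineticTheory.HeatConduction.pinnedChain ω₂ lam β γ).totalCurrent
              (μ0 (T + δ / 2) (T - δ / 2)))
          (∑ i : Fin N, ∫ x,
            (Literature.MathematicalPhysics.KineticTheory.HeatConduction.pinnedChain ω₂ lam β γ).bondCurrent N i x * U0 x
              ∂((Literature.MathematicalPhysics.KineticTheory.HeatConduction.pinnedChain ω₂ lam β γ).gibbsMeasure N T))
          0) →
    ∀ D0 : ℝ,
    Filter.Tendsto (fun δ : ℝ =>
        (Literature.MathematicalPhysics.KineticTheory.HeatConduction.pinnedChain ω₂ lam β γ).totalCurrent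
          (μ0 (T + δ / 2) (T - δ / 2)) / δ) (nhdsWithin 0 {(0 : ℝ)}ᶜ) (nhds D0) →
    ((N : ℝ) - 1) *
        ((1 / 2) * ∑ i : Fin N, ∫ x,
          (U0 x - U0 (Literature.MathematicalPhysics.KineticTheory.HeatConduction.momentumFlip i x)) ^ 2
            ∂((Literature.MathematicalPhysics.KineticTheory.HeatConduction.pinnedChain ω₂ lam β γ).gibbsMeasure N T)) ≤
      A * D0 ^ 2)
    (hNF : Summit.AtomisticToContinuum.FouriersLaw.Theses.VanishingNoiseTransfer.NoisyFourier) :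
    Summit.AtomisticToContinuum.FouriersLaw.Theses.VanishingNoiseTransfer.NoiseLocality :=
  noiseLocality_of_floor hC (floor_of_relativeFlipEnergyBound hC hNF)

/-- Registered helper sub-goal `helper_noiseLocalityOfRelativeFlipEnergyBound` of crux stmt-AtomisticToContinuum-11975 (line
`relative-flip-energy-transfer`) = `noiseLocality_of_relativeFlipEnergyBound` in registry form: C⁺ → X3 → `NoiseLocality`. [folklore] -/
theorem helper_noiseLocalityOfRelativeFlipEnergyBound : (∀ ω₂ lam β γ : ℝ, 0 < ω₂ → 0 < lam → 0 < β → 0 < γ → ∀ T : ℝ, 0 < T → ∃ A : ℝ, ∀ (N : ℕ) (μ0 : ℝ → ℝ → MeasureTheory.Measure (Literature.MathematicalPhysics.KineticTheory.HeatConduction.PhaseSpace N)), (∀ T_L T_R : ℝ, 0 < T_L → 0 < T_R → (Literature.MathematicalPhysics.KineticTheory.HeatConduction.pinnedChain ω₂ lam β γ).IsSteadyState N T_L T_R (μ0 T_L T_R) ∧ ∀ ν : MeasureTheory.Measure (Literature.MathematicalPhysics.KineticTheory.HeatConduction.PhaseSpace N), (Literature.MathematicalPhysics.KineticTheory.HeatConduction.pinnedChain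 ω₂ lam β γ).IsSteadyState N T_L T_R ν → ν = μ0 T_L T_R) → ∀ U0 : Literature.MathematicalPhysics.KineticTheory.HeatConduction.PhaseSpace N → ℝ, (MeasureTheory.MemLp U0 2 ((Literature.MathematicalPhysics.KineticTheory.HeatConduction.pinnedChain ω₂ lam β γ).gibbsMeasure N T) ∧ (∀ g : Literature.MathematicalPhysics.KineticTheory.HeatConduction.PhaseSpace N → ℝ, ContDiff ℝ ((⊤ : ℕ∞) : WithTop ℕ∞) g → HasCompactSupport g → HasDerivAt (fun δ : ℝ => ∫ x, g x ∂(μ0 (T + δ / 2) (T - δ / 2))) (∫ x, g x * U0 x ∂((Literature.MathematicalPhysics.KineticTheory.HeatConduction.pinnedChain ω₂ lam β γ).gibbsMeasure N T)) 0) ∧ HasDerivAt (fun δ : ℝ => (Literature.MathematicalPhysics.KineticTheory.HeatConduction.pinnedChain ω₂ lam β γ).totalCurrent (μ0 (T + δ / 2) (T - δ / 2))) (∑ i : Fin N, ∫ x, (Literature.MathematicalPhysics.KineticTheory.HeatConduction.pinnedChain ω₂ lam β γ).bondCurrent N i x * U0 x ∂((Literature.MathematicalPhysics.KineticTheory.HeatConduction.pinnedChain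 ω₂ lam β γ).gibbsMeasure N T)) 0) → ∀ D0 : ℝ, Filter.Tendsto (fun δ : ℝ => (Literature.MathematicalPhysics.KineticTheory.HeatConduction.pinnedChain ω₂ lam β γ).totalCurrent (μ0 (T + δ / 2) (T - δ / 2)) / δ) (nhdsWithin 0 {(0 : ℝ)}ᶜ) (nhds D0) → ((N : ℝ) - 1) * ((1 / 2) * ∑ i : Fin N, ∫ x, (U0 x - U0 (Literature.MathematicalPhysics.KineticTheory.HeatConduction.momentumFlip i x)) ^ 2 ∂((Literature.MathematicalPhysics.KineticTheory.HeatConduction.pinnedChain ω₂ lam β γ).gibbsMeasure N T)) ≤ A * D0 ^ 2) → Summit.AtomisticToContinuum.FouriersLaw.Theses.VanishingNoiseTransfer.NoisyFourier → Summit.AtomisticToContinuum.FouriersLaw.Theses.VanishingNoiseTransfer.NoiseLocality :=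
  fun hC hNF => noiseLocality_of_relativeFlipEnergyBound hC hNF

end Summit.AtomisticToContinuum.FouriersLaw.Theorems.NoiseLocality.Reduction

end
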